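/-
Copyright (c) 2026 the pub-hodgecm-mathlib formalisation cell (harness21).  Prover seat hodgecm-mathlib-K2Liu-p01 (g8), Track B «K2-LIT»,
#184♮ = hLiu418 = `stmt-HodgeConjecture-24832`; #42S organ S1 ROAD W, LAST-FILE brick (I) of the decomposition (bus 12:4xZ): the socket binder `hf₀out` and the support
LEVEL `M₀` of ★ (T4-core) from ★ F3b (L0) `exists_compact_profile_support` and the exhausting open boxes ★ (B) p860277.
-/
import Mathlib.Topology.Compactness.Compact
import Mathlib.Data.Complex.Basic
import HarnessLib

/-!
# Crux `HLiu418`, #42S-S1 ROAD W, brick (I): A COMPACT PROFILE SUPPORT LIES IN ONE BOX — the level `M₀` and the binder `hf₀out`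

Cell `hodgecm-mathlib`, crux item hLiu418 = `stmt-HodgeConjecture-24832` (helper lane `--supports … --as helper`, count-neutral).  THEOREMS ONLY (no `def`, no instance,
no notation, no named-fact hypothesis, no `sorry`).  GENERIC (topological spaces; Mathlib only).

WHY (SPEC-S1-AssemblySocket §2 rows `hf₀out` ∕ `Λ`; LAST-FILE decomposition (I)).  ★ F3b (L0) `K2LiuLocalSWSpanningCriterion.exists_compact_profile_support` gives, for a smooth
section `f₀` vanishing off the big cell, a COMPACT `S₀ ⊆ N_Δ` with `f₀(w_Δ n) ≠ 0 ⇒ n ∈ S₀`.  The coordinate `B : N_Δ → Skew_n` (★ F3e `blkB ∘ matA`, continuous) maps `S₀` to a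
compact set of matrices, and the boxes `BOX m` (★ (B) `isOpen_box`, `box_mono`, `exists_mem_box`) are an increasing open exhaustion — so ONE box `BOX M₀` contains `B(S₀)`
(Mathlib `IsCompact.elim_directed_cover`).  Hence **`hf₀out`**: `B(n) ∉ BOX M₀ ⇒ f₀(w_Δ n) = 0` (with `N₁ := N_{BOX M₀}`), and the level `M₀` of ★ (T4-core)'s `hsupp`.
* **`exists_subset_of_isCompact_of_exhaustion`** — a compact set lies in one member of a monotone open exhaustion (any preorder index with joins: `ℤ`, `ℕ`);
* **`exists_level_of_compact_support`** — the `hf₀out` shape: `∃ M₀, ∀ n ∈ N, B n ∉ box M₀ → F n = 0`;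
* `exists_nat_level_of_compact_support` — the same with an `ℕ`-indexed exhaustion read through `ℤ` (`box' k := box k`), for ★ (T4-core)'s `S : ℕ → AddSubgroup`.
[BernsteinZelevinsky1976, §1.5] [Kudla1994, §3] [CasselsFrohlichANT1967, Ch. II §10].
HONEST LABEL.  Count-neutral helper; `HC_CM` is proved only modulo the 7 printed citations (2 remaining named inputs: hLiu418 = `stmt-HodgeConjecture-24832`,
h413 = `stmt-HodgeConjecture-24833`) until rung 0 closes.

## References
* [BernsteinZelevinsky1976] I. N. Bernstein, A. V. Zelevinsky, Russian Math. Surveys 31 (1976), §1.5.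
* [Kudla1994] S. S. Kudla, Israel J. Math. 87 (1994), §3.
* [CasselsFrohlichANT1967] J. W. S. Cassels, A. Fröhlich (eds.), *Algebraic Number Theory* (1967), Ch. II §10.
-/

set_option autoImplicit false
set_option linter.dupNamespace false -- the mandated namespace repeats `HodgeConjecture.HodgeConjecture`

namespace Summit.HodgeConjecture.HodgeConjecture.Cruxes.HLiu418.K2LiuProfileSupportLevel

variable {G M ι : Type*} [TopologicalSpace G] [TopologicalSpace M]

/-- **a compact set lies in ONE member of a monotone open exhaustion** (directed cover). [cite: CasselsFrohlichANT1967, Ch. II §10] -/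
theorem exists_subset_of_isCompact_of_exhaustion [SemilatticeSup ι] [Nonempty ι] {box : ι → Set M} (hmono : Monotone box) (hopen : ∀ m, IsOpen (box m))
    (hex : ∀ t, ∃ m, t ∈ box m) {C : Set M} (hC : IsCompact C) : ∃ m, C ⊆ box m :=
  hC.elim_directed_cover box hopen (fun t _ => Set.mem_iUnion.2 (hex t)) (Monotone.directed_le hmono)

/-- **THE `hf₀out` SHAPE**: a profile `F` on `N` supported (where non-zero) in a compact `S₀ ⊆ N`, a coordinate `B` continuous on `N`, and a monotone open exhaustion
`box` of the coordinate space ⇒ `∃ M₀, ∀ n ∈ N, B n ∉ box M₀ → F n = 0`. [cite: BernsteinZelevinsky1976, §1.5] [cite: Kudla1994, §3] -/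
theorem exists_level_of_compact_support [SemilatticeSup ι] [Nonempty ι] {N : Set G} (B : G → M) (hB : ContinuousOn B N)
    {box : ι → Set M} (hmono : Monotone box) (hopen : ∀ m, IsOpen (box m)) (hex : ∀ t, ∃ m, t ∈ box m)
    {S₀ : Set G} (hS₀ : IsCompact S₀) (hS₀N : S₀ ⊆ N) {F : G → ℂ} (hF : ∀ n ∈ N, F n ≠ 0 → n ∈ S₀) :
    ∃ M₀, ∀ n ∈ N, B n ∉ box M₀ → F n = 0 := by
  obtain ⟨M₀, hM₀⟩ := exists_subset_of_isCompact_of_exhaustion hmono hopen hex (hS₀.image_of_continuousOn (hB.mono hS₀N))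
  refine ⟨M₀, fun n hn hnot => ?_⟩
  by_contra hne
  exact hnot (hM₀ ⟨n, hF n hn hne, rfl⟩)

/-- the profile SUPPORT LEVEL for an `ℕ`-indexed family read through `ℤ` (★ (T4-core)'s `S : ℕ → AddSubgroup`, `S k := Skew ⊓ BOX k`): with a monotone open `ℤ`-exhaustion,
`∃ M₀ : ℕ, ∀ n ∈ N, B n ∉ box (M₀ : ℤ) → F n = 0`. [cite: Kudla1994, §3] -/
theorem exists_nat_level_of_compact_support {N : Set G} (B : G → M) (hB : ContinuousOn B N)
    {box : ℤ → Set M} (hmono : Monotone box) (hopen : ∀ m, IsOpen (box m)) (hex : ∀ t, ∃ m, t ∈ box m)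
    {S₀ : Set G} (hS₀ : IsCompact S₀) (hS₀N : S₀ ⊆ N) {F : G → ℂ} (hF : ∀ n ∈ N, F n ≠ 0 → n ∈ S₀) :
    ∃ M₀ : ℕ, ∀ n ∈ N, B n ∉ box (M₀ : ℤ) → F n = 0 := by
  obtain ⟨M, hM⟩ := exists_level_of_compact_support B hB hmono hopen hex hS₀ hS₀N hF
  refine ⟨M.toNat, fun n hn hnot => hM n hn fun h => hnot (hmono (Int.self_le_toNat M) h)⟩

omit [TopologicalSpace G] [TopologicalSpace M] in
/-- monotone in the level: vanishing outside `box M₀` implies vanishing outside `box M` for `M₀ ≤ M`. [folklore] -/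
theorem level_mono [Preorder ι] {N : Set G} (B : G → M) {box : ι → Set M} (hmono : Monotone box) {F : G → ℂ} {M₀ M₁ : ι} (h : M₀ ≤ M₁)
    (hF : ∀ n ∈ N, B n ∉ box M₀ → F n = 0) : ∀ n ∈ N, B n ∉ box M₁ → F n = 0 :=
  fun n hn hnot => hF n hn fun h' => hnot (hmono h h')

end Summit.HodgeConjecture.HodgeConjecture.Cruxes.HLiu418.K2LiuProfileSupportLevel
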